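/-
Copyright (c) 2026 the pub-hodgecm-mathlib formalisation cell (harness21).  Prover seat hodgecm-mathlib-K2E1-p11 (g3), Track B ∕ K2-LIT, h413 = `stmt-HodgeConjecture-24833`,
R90-TF section S8 «ContSpec-n½», #2 road (G side), S8 dealer R90-CS-plan (g2) S8-R94 (2), 2026-09-04T23:01:40Z: the per-block STABILITY letter — the `(K′, ω)`-block
`resGBlock L μ K′ ω χ₁ χ₂` is stable under `R(k)` for every `k` that commutes with `K′` and preserves the Borel height (so under `R(ι_∞ k_∞)`, `k_∞ ∈ K_∞`, at the finite level
`K′ = ι_f(Kf)`) — the `hS` of ★ `topologicalClosure_iSup_inf_le` (p862838) that K2E1-p14's K-type glue consumes.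
-/
import Summits.HodgeConjecture.HodgeConjecture.Theorems.R90S8ResGBlockIsotypicU3     -- ★ p862820 (K2E1-p12): `eisensteinSeriesU_pairRadialSection_quotientSubgroup_mul` (left `G(F)`-invariance of `E((f∘H)·φ)`); brings ★ G-DEFS p862621, ★ `quotFun_rightTranslation`
import HarnessLib

/-!
# S8 #2 road (G side) — `R90S8ResGBlockArchStableU3`: the Borel block `Sc(K′, ω; χ₁, χ₂)` of `L²(U_{L/L⁺}(3))` is STABLE under right translation `R(k)` by every `k ∈ G(𝔸)` that
# COMMUTES with `K′` and PRESERVES THE BOREL HEIGHT (e.g. `k = ι_∞(k_∞)`, `k_∞ ∈ K_∞`, at `K′ = ι_f(Kf)`) — the `K_∞`-stability `hS` of the K-type glue ★ `R90S8ProjectionCommutesSupClosure`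

Track B ∕ K2-LIT, crux h413 = `stmt-HodgeConjecture-24833`, route of record `HCCMUnconditional`; cell `hodgecm-mathlib`, R90-TF programme, section S8 «ContSpec-n½», socket #2's ED. 5
sub-socket (E) at the K-TYPE index (S8-R82 ∕ S8-R87 ∕ S8-R94 (2)).  THEOREMS ONLY (no `def`, no `instance`, no `notation`, no named-fact hypothesis, no `sorry`; default heartbeats);
lane `--supports stmt-HodgeConjecture-24833 --as helper` (count-neutral).  CLOSES NO SOCKET.

THE MATHEMATICS ([MoeglinWaldspurger1995] II.1.1, II.1.5; [BorelJacquet1979] §4.6).  For `k ∈ G(𝔸)` with (i) `H(g k) = H(g)` for all `g` (`hHk` — the Borel height is right-invariant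
under the height-preserving maximal compact, ★ `borelHeight_mul_of_mem_comap_standardMaximalCompactGL`; in particular under `ι_∞(K_∞)`) and (ii) `k′ k = k k′` for all `k′ ∈ K′` (`hcomm` —
for `K′ = ι_f(Kf)` and `k = ι_∞(k_∞)` this is ★ `commute_archToAdelic_finAdelicToAdelic`), right translation `r(k)` maps a continuous section `φ ∈ V(χ₁, χ₂; K′, ω)` to the continuous
section `r(k)φ = φ(· k) ∈ V(χ₁, χ₂; K′, ω)` (§1), the profile `(f∘H)·φ` to `(f∘H)·r(k)φ`, and the Eisenstein series accordingly (`E(r(k)Φ) = r(k)E(Φ)`, termwise); with ★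
`quotFun_rightTranslation` (left `G(F)`-invariance from ★ `eisensteinSeriesU_pairRadialSection_quotientSubgroup_mul`, `χ₂` automorphic) and ★ `rightRegular_apply_coeFn` this says
`R(k)[θ_{f,φ}] = [θ_{f, r(k)φ}]` in `L²` (§2) — a GENERATOR of `Sc(K′, ω; χ₁, χ₂)` goes to a generator; `span` and closure follow by linearity and continuity of `R(k)` (§3).  §4: the atoms
`resGAtom U` and lines `resGLine U` are then stable GIVEN the intertwining letter on the model map `U` («`R(k)` preserves the vanishing of the line coordinate on the block», resp. the
same for `k⁻¹` on the atoms — unitarity ★ `IsUnitary.adjoint_apply`).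
* §1 `rightTranslation_mem_chiSectionSpacePair` (+ `eisensteinSeriesU_rightTranslation`, `pairProfile_rightTranslation`).
* §2 `rightRegular_apply_toLp_pairBrick_eq_toLp` — `R(k)[θ_{f,φ}] = [θ_{f, r(k)φ}]`.
* §3 **`rightRegular_apply_mem_resGBlock`** ∕ **`map_rightRegular_resGBlock_le`** — THE STABILITY LETTER (`hS` of ★ p862838 at `S_b := resGBlock L μ K′ ω (χ₁ b) (χ₂ b)`).
* §4 `rightRegular_apply_mem_resGAtom` (given `hU`), `rightRegular_apply_mem_resGLine` (given `hU` and the `k⁻¹`-stability of the atoms).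
HONEST LABEL: HC_CM is proved only modulo the 7 printed citations (2 remaining named inputs: hLiu418 = `stmt-HodgeConjecture-24832`, h413 = `stmt-HodgeConjecture-24833`) until rung 0
closes; REL ≠ ★ ≠ BUILT; a stability letter pays no socket; count-neutral.
-/

set_option autoImplicit false
set_option linter.dupNamespace false  -- the mandated namespace `…HodgeConjecture.HodgeConjecture.R90.S8` (LEAD #1 L1) repeats the summit's segment

noncomputable section

open MeasureTheory Measure Set Filter Topology NumberField ContRepresentation
open Literature.NumberTheory Literature.NumberTheory.Automorphic Literature.NumberTheory.Automorphic.UnitaryGroup Literature.NumberTheory.GaloisRepresentations AdelicGroupData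
open Literature.NumberTheory.Automorphic.Arthur2013.Leaves.TECR
open Summit.HodgeConjecture.HodgeConjecture.Cruxes.H413.K2E1BorelEisensteinU
open Summit.HodgeConjecture.HodgeConjecture.Cruxes.H413.K2E1CharacterEisensteinU3PairDefs
open Summit.HodgeConjecture.HodgeConjecture.Cruxes.H413.K2E1ChiSectionSpaceU3PairDefs
open scoped ENNReal NNReal InnerProductSpace

namespace Summit.HodgeConjecture.HodgeConjecture.R90.S8

section ArchStable

variable (L : Type) [Field L] [NumberField L] [IsCMField L]
  [MeasurableSpace (quasiSplit (↥(maximalRealSubfield L)) L (IsCMField.complexConj L) 3).Adelic] [BorelSpace (quasiSplit (↥(maximalRealSubfield L)) L (IsCMField.complexConj L) 3).Adelic]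
  (μ : Measure (quasiSplit (↥(maximalRealSubfield L)) L (IsCMField.complexConj L) 3).automorphicQuotient) [(quasiSplit (↥(maximalRealSubfield L)) L (IsCMField.complexConj L) 3).IsAutomorphicMeasure μ]

/-! ## §1 Right translation by a commuting, height-preserving `k` preserves the section space, the profile and the Eisenstein series -/

omit [MeasurableSpace (quasiSplit (↥(maximalRealSubfield L)) L (IsCMField.complexConj L) 3).Adelic] [BorelSpace (quasiSplit (↥(maximalRealSubfield L)) L (IsCMField.complexConj L) 3).Adelic] in
/-- **`r(k)φ ∈ V(χ₁, χ₂; K′, ω)`** for `φ ∈ V(χ₁, χ₂; K′, ω)` and `k` commuting with `K′`: the LEFT pair-section law is untouched by right translation, and `φ(g k′ k) = φ(g k k′) = ω(k′) φ(g k)`.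
[cite: MoeglinWaldspurger1995, II.1.1] -/
theorem rightTranslation_mem_chiSectionSpacePair {χ₁ : HeckeCharacter L} {χ₂ : ↥(TorusDict.torus (IsCMField.complexConj L)) →ₜ* ℂˣ}
    {K' : Subgroup (quasiSplit (↥(maximalRealSubfield L)) L (IsCMField.complexConj L) 3).Adelic} {ω : ↥K' → ℂ} {k : (quasiSplit (↥(maximalRealSubfield L)) L (IsCMField.complexConj L) 3).Adelic}
    (hcomm : ∀ k' ∈ K', k' * k = k * k') {φ : (quasiSplit (↥(maximalRealSubfield L)) L (IsCMField.complexConj L) 3).Adelic → ℂ} (hφ : φ ∈ chiSectionSpacePair χ₁ χ₂ K' ω) :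
    rightTranslation (quasiSplit (↥(maximalRealSubfield L)) L (IsCMField.complexConj L) 3) k φ ∈ chiSectionSpacePair χ₁ χ₂ K' ω := by
  refine ⟨fun b hb g => ?_, fun g k' => ?_⟩
  · rw [rightTranslation_apply, rightTranslation_apply, mul_assoc b g k]
    exact isChiSectionPair_of_mem hφ b hb (g * k)
  · rw [rightTranslation_apply, rightTranslation_apply, mul_assoc, hcomm _ k'.2, ← mul_assoc]
    exact apply_mul_of_mem hφ (g * k) k'

omit [MeasurableSpace (quasiSplit (↥(maximalRealSubfield L)) L (IsCMField.complexConj L) 3).Adelic] [BorelSpace (quasiSplit (↥(maximalRealSubfield L)) L (IsCMField.complexConj L) 3).Adelic] in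
/-- **`E(r(k)Φ) = r(k) E(Φ)`** — the Eisenstein sum is over LEFT cosets `B(F)∖G(F)`, right translation passes termwise (`mul_assoc`). [cite: MoeglinWaldspurger1995, II.1.5] -/
theorem eisensteinSeriesU_rightTranslation (Φ : (quasiSplit (↥(maximalRealSubfield L)) L (IsCMField.complexConj L) 3).Adelic → ℂ) (k g : (quasiSplit (↥(maximalRealSubfield L)) L (IsCMField.complexConj L) 3).Adelic) :
    eisensteinSeriesU (rightTranslation (quasiSplit (↥(maximalRealSubfield L)) L (IsCMField.complexConj L) 3) k Φ) g = eisensteinSeriesU Φ (g * k) := by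
  rw [eisensteinSeriesU_def, eisensteinSeriesU_def]
  exact tsum_congr fun q => by rw [rightTranslation_apply, mul_assoc]

omit [MeasurableSpace (quasiSplit (↥(maximalRealSubfield L)) L (IsCMField.complexConj L) 3).Adelic] [BorelSpace (quasiSplit (↥(maximalRealSubfield L)) L (IsCMField.complexConj L) 3).Adelic] in
/-- **The profile transforms as the section**: `r(k)((f∘H)·φ) = (f∘H)·r(k)φ` when `H(g k) = H(g)`. [cite: MoeglinWaldspurger1995, II.1.1] -/
theorem pairProfile_rightTranslation {k : (quasiSplit (↥(maximalRealSubfield L)) L (IsCMField.complexConj L) 3).Adelic}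
    (hHk : ∀ g : (quasiSplit (↥(maximalRealSubfield L)) L (IsCMField.complexConj L) 3).Adelic, borelHeight (g * k) = borelHeight g)
    (f : ℝ → ℂ) (φ : (quasiSplit (↥(maximalRealSubfield L)) L (IsCMField.complexConj L) 3).Adelic → ℂ) :
    rightTranslation (quasiSplit (↥(maximalRealSubfield L)) L (IsCMField.complexConj L) 3) k
        (fun x : (quasiSplit (↥(maximalRealSubfield L)) L (IsCMField.complexConj L) 3).Adelic => f (borelHeight x : ℝ) * φ x) =
      fun x : (quasiSplit (↥(maximalRealSubfield L)) L (IsCMField.complexConj L) 3).Adelic =>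
        f (borelHeight x : ℝ) * rightTranslation (quasiSplit (↥(maximalRealSubfield L)) L (IsCMField.complexConj L) 3) k φ x := by
  funext x
  simp only [rightTranslation_apply, hHk x]

/-! ## §2 `R(k)[θ_{f,φ}] = [θ_{f, r(k)φ}]` in `L²` -/

/-- **`R(k)[θ_{f,φ}] = [θ_{f, r(k)φ}]`**: for `k` preserving the Borel height, `χ₂` automorphic (left `G(F)`-invariance of the wave packet, ★
`eisensteinSeriesU_pairRadialSection_quotientSubgroup_mul`) and a square-integrable wave packet `[θ_{f,φ}]`, the class `R(k)[θ_{f,φ}]` is the (square-integrable) wave packet of the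
translated section — ★ `quotFun_rightTranslation` + ★ `rightRegular_apply_coeFn`, the proof of ★ `rightRegular_apply_toLp_pairBrick_eq_smul` without the eigen-scalar.
[cite: MoeglinWaldspurger1995, II.1.1, II.1.5] [cite: BorelJacquet1979, §4.6] -/
theorem rightRegular_apply_toLp_pairBrick_eq_toLp {k : (quasiSplit (↥(maximalRealSubfield L)) L (IsCMField.complexConj L) 3).Adelic}
    (hHk : ∀ g : (quasiSplit (↥(maximalRealSubfield L)) L (IsCMField.complexConj L) 3).Adelic, borelHeight (g * k) = borelHeight g)
    {χ₁ : HeckeCharacter L} {χ₂ : ↥(TorusDict.torus (IsCMField.complexConj L)) →ₜ* ℂˣ} (hχ₂ : TorusDict.IsAutomorphic (IsCMField.complexConj L) χ₂)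
    {f : ℝ → ℂ} {φ : (quasiSplit (↥(maximalRealSubfield L)) L (IsCMField.complexConj L) 3).Adelic → ℂ} (hφ : IsChiSectionPair χ₁ χ₂ φ)
    (hv : MemLp ((quasiSplit (↥(maximalRealSubfield L)) L (IsCMField.complexConj L) 3).quotFun (eisensteinSeriesU (fun g : (quasiSplit (↥(maximalRealSubfield L)) L (IsCMField.complexConj L) 3).Adelic => f (borelHeight g : ℝ) * φ g))) 2 μ) :
    ∃ hv' : MemLp ((quasiSplit (↥(maximalRealSubfield L)) L (IsCMField.complexConj L) 3).quotFun (eisensteinSeriesU (fun g : (quasiSplit (↥(maximalRealSubfield L)) L (IsCMField.complexConj L) 3).Adelic =>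
        f (borelHeight g : ℝ) * rightTranslation (quasiSplit (↥(maximalRealSubfield L)) L (IsCMField.complexConj L) 3) k φ g))) 2 μ,
      ((quasiSplit (↥(maximalRealSubfield L)) L (IsCMField.complexConj L) 3).rightRegular μ) k (hv.toLp _) = hv'.toLp _ := by
  -- the Eisenstein series of the profile transforms by right translation
  have hrt : rightTranslation (quasiSplit (↥(maximalRealSubfield L)) L (IsCMField.complexConj L) 3) k (eisensteinSeriesU (fun g : (quasiSplit (↥(maximalRealSubfield L)) L (IsCMField.complexConj L) 3).Adelic => f (borelHeight g : ℝ) * φ g)) =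
      eisensteinSeriesU (fun g : (quasiSplit (↥(maximalRealSubfield L)) L (IsCMField.complexConj L) 3).Adelic =>
        f (borelHeight g : ℝ) * rightTranslation (quasiSplit (↥(maximalRealSubfield L)) L (IsCMField.complexConj L) 3) k φ g) := by
    funext g
    rw [rightTranslation_apply, ← pairProfile_rightTranslation L hHk f φ, eisensteinSeriesU_rightTranslation]
  -- right translation on `G(𝔸)` = the left action on the quotient
  have hinv := eisensteinSeriesU_pairRadialSection_quotientSubgroup_mul L hφ hχ₂ f
  have h3 := AdelicGroupData.quotFun_rightTranslation hinv k
  rw [hrt] at h3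
  -- the class `R(k)[θ_{f,φ}]` is a.e. the quotient function of the translated wave packet
  have hae : (((quasiSplit (↥(maximalRealSubfield L)) L (IsCMField.complexConj L) 3).rightRegular μ) k (hv.toLp _) : (quasiSplit (↥(maximalRealSubfield L)) L (IsCMField.complexConj L) 3).automorphicQuotient → ℂ) =ᵐ[μ]
      (quasiSplit (↥(maximalRealSubfield L)) L (IsCMField.complexConj L) 3).quotFun (eisensteinSeriesU (fun g : (quasiSplit (↥(maximalRealSubfield L)) L (IsCMField.complexConj L) 3).Adelic =>
        f (borelHeight g : ℝ) * rightTranslation (quasiSplit (↥(maximalRealSubfield L)) L (IsCMField.complexConj L) 3) k φ g)) := by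
    have h1 := (quasiSplit (↥(maximalRealSubfield L)) L (IsCMField.complexConj L) 3).rightRegular_apply_coeFn μ k (hv.toLp _)
    have h2 := (measurePreserving_smul k⁻¹ μ).quasiMeasurePreserving.ae_eq_comp hv.coeFn_toLp
    exact h1.trans (h2.trans (Filter.Eventually.of_forall fun x => (congrFun h3 x).symm))
  refine ⟨(Lp.memLp _).ae_eq hae, Lp.ext (hae.trans (MemLp.coeFn_toLp _).symm)⟩

/-! ## §3 The stability letter: `R(k) Sc(K′, ω; χ₁, χ₂) ≤ Sc(K′, ω; χ₁, χ₂)` -/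

/-- **THE `K_∞`-STABILITY LETTER OF THE BOREL BLOCK** (pointwise form): for `k ∈ G(𝔸)` commuting with `K′` and preserving the Borel height, and `χ₂` automorphic, `R(k)` maps
`Sc(K′, ω; χ₁, χ₂) = resGBlock L μ K′ ω χ₁ χ₂` into itself — generators to generators (§2 with §1), span by linearity, closure by continuity of `R(k)`.  At `K′ := ι_f(Kf)`, `ω := 1`,
`k := ι_∞(k_∞)` (★ `commute_archToAdelic_finAdelicToAdelic`, height invariance of `K_∞`) this is the `hS` of ★ `topologicalClosure_iSup_inf_le` (K-type glue).
[cite: MoeglinWaldspurger1995, II.1.1, II.1.5, II.2.4] [cite: BorelJacquet1979, §4.6] -/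
theorem rightRegular_apply_mem_resGBlock (K' : Subgroup (quasiSplit (↥(maximalRealSubfield L)) L (IsCMField.complexConj L) 3).Adelic) (ω : ↥K' →* ℂ)
    {k : (quasiSplit (↥(maximalRealSubfield L)) L (IsCMField.complexConj L) 3).Adelic}
    (hHk : ∀ g : (quasiSplit (↥(maximalRealSubfield L)) L (IsCMField.complexConj L) 3).Adelic, borelHeight (g * k) = borelHeight g) (hcomm : ∀ k' ∈ K', k' * k = k * k')
    (χ₁ : HeckeCharacter L) {χ₂ : ↥(TorusDict.torus (IsCMField.complexConj L)) →ₜ* ℂˣ} (hχ₂ : TorusDict.IsAutomorphic (IsCMField.complexConj L) χ₂)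
    {v : (quasiSplit (↥(maximalRealSubfield L)) L (IsCMField.complexConj L) 3).L2 μ} (hv : v ∈ resGBlock L μ K' ω χ₁ χ₂) :
    ((quasiSplit (↥(maximalRealSubfield L)) L (IsCMField.complexConj L) 3).rightRegular μ) k v ∈ resGBlock L μ K' ω χ₁ χ₂ := by
  -- `resGBlock = closure (span gens)`; `R(k)` is continuous linear, so it suffices to send the generators into the (closed) target
  rw [resGBlock_def] at hv ⊢
  refine (Submodule.topologicalClosure_minimal _ (Submodule.span_le.2 ?_)
    ((Submodule.isClosed_topologicalClosure _).preimage (((quasiSplit (↥(maximalRealSubfield L)) L (IsCMField.complexConj L) 3).rightRegular μ) k).continuous) :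
    (Submodule.span ℂ _).topologicalClosure ≤ ((Submodule.span ℂ _).topologicalClosure).comap
      ((((quasiSplit (↥(maximalRealSubfield L)) L (IsCMField.complexConj L) 3).rightRegular μ) k :
        (quasiSplit (↥(maximalRealSubfield L)) L (IsCMField.complexConj L) 3).L2 μ →L[ℂ] (quasiSplit (↥(maximalRealSubfield L)) L (IsCMField.complexConj L) 3).L2 μ) :
        (quasiSplit (↥(maximalRealSubfield L)) L (IsCMField.complexConj L) 3).L2 μ →ₗ[ℂ] (quasiSplit (↥(maximalRealSubfield L)) L (IsCMField.complexConj L) 3).L2 μ)) hv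
  rintro _ ⟨f, hf, hfs, hf0, φ, hφ, hφc, hw, rfl⟩
  obtain ⟨hw', hTw⟩ := rightRegular_apply_toLp_pairBrick_eq_toLp L μ hHk hχ₂ (isChiSectionPair_of_mem hφ) hw (f := f) (k := k)
  have hck : Continuous (rightTranslation (quasiSplit (↥(maximalRealSubfield L)) L (IsCMField.complexConj L) 3) k φ) := by
    have h : rightTranslation (quasiSplit (↥(maximalRealSubfield L)) L (IsCMField.complexConj L) 3) k φ = fun g => φ (g * k) := funext fun g => rfl
    rw [h]
    exact hφc.comp (continuous_id.mul continuous_const)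
  rw [SetLike.mem_coe, Submodule.mem_comap, ContinuousLinearMap.coe_coe, hTw]
  exact Submodule.le_topologicalClosure _ (Submodule.subset_span ⟨f, hf, hfs, hf0, _, rightTranslation_mem_chiSectionSpacePair L hcomm hφ, hck, hw', rfl⟩)

/-- **THE `K_∞`-STABILITY LETTER, lattice form**: `Sc(K′, ω; χ₁, χ₂).map R(k) ≤ Sc(K′, ω; χ₁, χ₂)`. [cite: MoeglinWaldspurger1995, II.2.4] [cite: BorelJacquet1979, §4.6] -/
theorem map_rightRegular_resGBlock_le (K' : Subgroup (quasiSplit (↥(maximalRealSubfield L)) L (IsCMField.complexConj L) 3).Adelic) (ω : ↥K' →* ℂ)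
    {k : (quasiSplit (↥(maximalRealSubfield L)) L (IsCMField.complexConj L) 3).Adelic}
    (hHk : ∀ g : (quasiSplit (↥(maximalRealSubfield L)) L (IsCMField.complexConj L) 3).Adelic, borelHeight (g * k) = borelHeight g) (hcomm : ∀ k' ∈ K', k' * k = k * k')
    (χ₁ : HeckeCharacter L) {χ₂ : ↥(TorusDict.torus (IsCMField.complexConj L)) →ₜ* ℂˣ} (hχ₂ : TorusDict.IsAutomorphic (IsCMField.complexConj L) χ₂) :
    (resGBlock L μ K' ω χ₁ χ₂).map ((((quasiSplit (↥(maximalRealSubfield L)) L (IsCMField.complexConj L) 3).rightRegular μ) k :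
      (quasiSplit (↥(maximalRealSubfield L)) L (IsCMField.complexConj L) 3).L2 μ →L[ℂ] (quasiSplit (↥(maximalRealSubfield L)) L (IsCMField.complexConj L) 3).L2 μ) :
      (quasiSplit (↥(maximalRealSubfield L)) L (IsCMField.complexConj L) 3).L2 μ →ₗ[ℂ] (quasiSplit (↥(maximalRealSubfield L)) L (IsCMField.complexConj L) 3).L2 μ) ≤ resGBlock L μ K' ω χ₁ χ₂ := by
  rintro _ ⟨v, hv, rfl⟩
  exact rightRegular_apply_mem_resGBlock L μ K' ω hHk hcomm χ₁ hχ₂ hv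

/-! ## §4 Atoms and lines, given the intertwining letter on the model map `U` -/

variable {A M Λ : Type*} [AddCommGroup A] [Module ℂ A] [AddCommGroup M] [Module ℂ M] [AddCommGroup Λ] [Module ℂ Λ]

/-- **The atoms are `R(k)`-stable GIVEN the model letter `hU`** («`R(k)` preserves the vanishing of the LINE coordinate on the block» — a property of the payers' block-model map `U`, e.g.
because `U` intertwines `R(k)` with a map preserving `A × M`). [cite: MoeglinWaldspurger1995, VI.2] -/
theorem rightRegular_apply_mem_resGAtom (K' : Subgroup (quasiSplit (↥(maximalRealSubfield L)) L (IsCMField.complexConj L) 3).Adelic) (ω : ↥K' →* ℂ)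
    {k : (quasiSplit (↥(maximalRealSubfield L)) L (IsCMField.complexConj L) 3).Adelic}
    (hHk : ∀ g : (quasiSplit (↥(maximalRealSubfield L)) L (IsCMField.complexConj L) 3).Adelic, borelHeight (g * k) = borelHeight g) (hcomm : ∀ k' ∈ K', k' * k = k * k')
    (χ₁ : HeckeCharacter L) {χ₂ : ↥(TorusDict.torus (IsCMField.complexConj L)) →ₜ* ℂˣ} (hχ₂ : TorusDict.IsAutomorphic (IsCMField.complexConj L) χ₂)
    (U : (quasiSplit (↥(maximalRealSubfield L)) L (IsCMField.complexConj L) 3).L2 μ →ₗ[ℂ] (A × M) × Λ)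
    (hU : ∀ w ∈ resGBlock L μ K' ω χ₁ χ₂, (U w).2 = 0 → (U (((quasiSplit (↥(maximalRealSubfield L)) L (IsCMField.complexConj L) 3).rightRegular μ) k w)).2 = 0)
    {v : (quasiSplit (↥(maximalRealSubfield L)) L (IsCMField.complexConj L) 3).L2 μ} (hv : v ∈ resGAtom L μ U K' ω χ₁ χ₂) :
    ((quasiSplit (↥(maximalRealSubfield L)) L (IsCMField.complexConj L) 3).rightRegular μ) k v ∈ resGAtom L μ U K' ω χ₁ χ₂ :=
  (mem_resGAtom_iff L μ U K' ω χ₁ χ₂ _).2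
    ⟨rightRegular_apply_mem_resGBlock L μ K' ω hHk hcomm χ₁ hχ₂ ((mem_resGAtom_iff L μ U K' ω χ₁ χ₂ v).1 hv).1,
      hU v ((mem_resGAtom_iff L μ U K' ω χ₁ χ₂ v).1 hv).1 ((mem_resGAtom_iff L μ U K' ω χ₁ χ₂ v).1 hv).2⟩

/-- **The lines are `R(k)`-stable GIVEN the model letter for `k⁻¹`** (`hUinv`: the atoms are `R(k⁻¹)`-stable; `k⁻¹` commutes with `K′` and preserves the height whenever `k` does): `R(k)`
preserves the block (§3) and — by unitarity, `⟪a, R(k) v⟫ = ⟪R(k⁻¹) a, v⟫` (★ `IsUnitary.adjoint_apply`) — the orthocomplement of the atoms. [cite: MoeglinWaldspurger1995, VI.2] [cite: BorelJacquet1979, §4.6] -/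
theorem rightRegular_apply_mem_resGLine (K' : Subgroup (quasiSplit (↥(maximalRealSubfield L)) L (IsCMField.complexConj L) 3).Adelic) (ω : ↥K' →* ℂ)
    {k : (quasiSplit (↥(maximalRealSubfield L)) L (IsCMField.complexConj L) 3).Adelic}
    (hHk : ∀ g : (quasiSplit (↥(maximalRealSubfield L)) L (IsCMField.complexConj L) 3).Adelic, borelHeight (g * k) = borelHeight g) (hcomm : ∀ k' ∈ K', k' * k = k * k')
    (χ₁ : HeckeCharacter L) {χ₂ : ↥(TorusDict.torus (IsCMField.complexConj L)) →ₜ* ℂˣ} (hχ₂ : TorusDict.IsAutomorphic (IsCMField.complexConj L) χ₂)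
    (U : (quasiSplit (↥(maximalRealSubfield L)) L (IsCMField.complexConj L) 3).L2 μ →ₗ[ℂ] (A × M) × Λ)
    (hUinv : ∀ a ∈ resGAtom L μ U K' ω χ₁ χ₂, ((quasiSplit (↥(maximalRealSubfield L)) L (IsCMField.complexConj L) 3).rightRegular μ) k⁻¹ a ∈ resGAtom L μ U K' ω χ₁ χ₂)
    {v : (quasiSplit (↥(maximalRealSubfield L)) L (IsCMField.complexConj L) 3).L2 μ} (hv : v ∈ resGLine L μ U K' ω χ₁ χ₂) :
    ((quasiSplit (↥(maximalRealSubfield L)) L (IsCMField.complexConj L) 3).rightRegular μ) k v ∈ resGLine L μ U K' ω χ₁ χ₂ := by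
  refine (mem_resGLine_iff L μ U K' ω χ₁ χ₂ _).2 ⟨rightRegular_apply_mem_resGBlock L μ K' ω hHk hcomm χ₁ hχ₂ ((mem_resGLine_iff L μ U K' ω χ₁ χ₂ v).1 hv).1, ?_⟩
  have hvperp := ((mem_resGLine_iff L μ U K' ω χ₁ χ₂ v).1 hv).2
  rw [Submodule.mem_orthogonal] at hvperp ⊢
  intro a ha
  -- `⟪a, R(k) v⟫ = ⟪R(k)† a, v⟫ = ⟪R(k⁻¹) a, v⟫ = 0`
  rw [← ContinuousLinearMap.adjoint_inner_left, ((quasiSplit (↥(maximalRealSubfield L)) L (IsCMField.complexConj L) 3).isUnitary_rightRegular μ).adjoint_apply]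
  exact hvperp _ (hUinv a ha)

end ArchStable

end Summit.HodgeConjecture.HodgeConjecture.R90.S8

end
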